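import Mathlib.GroupTheory.Index
import Mathlib.Data.Nat.Log
import Mathlib.Probability.ProbabilityMassFunction.Constructions
import Literature.Probability.Distributions.IndepProductLaw
import HarnessLib

/-!
# Hallgren 2005 / class numbers under GRH — step N5: random elements generate a finite group
# (counting subgroups, and the union bound over proper subgroups)

Topic `Literature/Computability/Cryptography`; proof companion of `HallgrenClassGroup.lean`
(named fact `Hallgren2005_classNumber_qsolvable_of_GRH`). Everything here is PROVED (theorems
only; no definition, no named fact).

The class-number algorithm draws `T` independent random forms of discriminant `−d` and computes the
order of the subgroup of `Cl(−d)` they generate; it is correct when they generate the whole class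
group. If every PROPER subgroup is escaped by one draw with probability `≥ 1 − θ`, then `T` draws
fail to generate with probability `≤ #{subgroups} · θ^T` (union bound over the proper subgroup
generated by the draws), and a finite group `G` has at most `(|G| + 1)^{⌊log₂|G|⌋}` subgroups since
every subgroup is generated by `≤ log₂|G|` elements (each new generator at least doubles the order,
Lagrange). With `|Cl(−d)| ≤ d²` this makes `T = poly(log d)` draws enough.

* `exists_finset_closure_eq` — every subgroup `H` of a finite group is `closure S` for a finite
  `S` with `2^{#S} ≤ |H|`;
* `card_subgroup_le` — `#{subgroups of G} ≤ (|G| + 1)^{⌊log₂ |G|⌋}`;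
* `toOuterMeasure_closure_ne_top_le` — for `T` independent draws `ω_t ∼ μ` and a set-valued read-out
  `X : Ω → Set G`: if `μ{X ω ⊆ H} ≤ θ` for every proper subgroup `H`, then
  `Pr[closure (⋃_t X ω_t) ≠ ⊤] ≤ #{subgroups of G} · θ^T`.

## References

* I. M. Isaacs, *Finite Group Theory* (2008), Lemma-level folklore: a finite group of order `n` is
  generated by at most `log₂ n` elements [folklore].
* K. K. H. Cheung, M. Mosca, *Decomposing finite abelian groups*, Quantum Inf. Comput. 1 (2001),
  §3 (random elements generate with high probability) [CheungMosca2001].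
* A. M. Childs, W. van Dam, Rev. Mod. Phys. 82 (2010), §5.7 [ChildsVandam2010].
-/

noncomputable section

open scoped ENNReal

namespace Literature.Computability.Cryptography.Hallgren2005

/-! ### Every subgroup of a finite group is generated by few elements -/

section GroupTheory

variable {G : Type*} [Group G] [Finite G]

/-- **A subgroup of a finite group is generated by a set `S` with `2^{#S} ≤ |H|`.** Greedy: a finite
subset `S ⊆ H` with `2^{#S} ≤ |⟨S⟩|` of maximal size generates `H`, for otherwise adding an element of
`H ∖ ⟨S⟩` at least doubles `|⟨S⟩|` (Lagrange). [folklore] -/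
theorem exists_finset_closure_eq (H : Subgroup G) :
    ∃ S : Finset G, Subgroup.closure (S : Set G) = H ∧ 2 ^ S.card ≤ Nat.card H := by
  classical
  haveI := Fintype.ofFinite G
  set 𝒮 : Finset (Finset G) := Finset.univ.filter fun S =>
    (S : Set G) ⊆ H ∧ 2 ^ S.card ≤ Nat.card (Subgroup.closure (S : Set G)) with h𝒮
  have hne : 𝒮.Nonempty := by
    refine ⟨∅, Finset.mem_filter.mpr ⟨Finset.mem_univ _, by simp, ?_⟩⟩
    simp only [Finset.card_empty, pow_zero]
    exact Nat.one_le_iff_ne_zero.mpr (Nat.card_pos (α := Subgroup.closure ((∅ : Finset G) : Set G))).ne'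
  obtain ⟨S, hS, hmax⟩ := Finset.exists_max_image 𝒮 Finset.card hne
  obtain ⟨-, hSH, hS2⟩ := Finset.mem_filter.mp hS
  have hle : Subgroup.closure (S : Set G) ≤ H := (Subgroup.closure_le H).mpr hSH
  rcases hle.eq_or_lt with heq | hlt
  · exact ⟨S, heq, heq ▸ hS2⟩
  · exfalso
    obtain ⟨g, hgH, hgS⟩ := SetLike.exists_of_lt hlt
    have hgS' : g ∉ S := fun h => hgS (Subgroup.subset_closure h)
    set S' : Finset G := insert g S with hS'
    have hcard : S'.card = S.card + 1 := Finset.card_insert_of_notMem hgS'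
    have hsub : (S' : Set G) ⊆ H := by
      rw [hS', Finset.coe_insert]
      exact Set.insert_subset hgH hSH
    have hmono : Subgroup.closure (S : Set G) ≤ Subgroup.closure (S' : Set G) :=
      Subgroup.closure_mono (by rw [hS', Finset.coe_insert]; exact Set.subset_insert _ _)
    have hne' : Subgroup.closure (S : Set G) ≠ Subgroup.closure (S' : Set G) := by
      intro h
      apply hgS
      rw [h]
      exact Subgroup.subset_closure (by rw [hS', Finset.coe_insert]; exact Set.mem_insert _ _)
    -- Lagrange: the index is at least `2`
    have hdvd := Subgroup.card_dvd_of_le hmono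
    obtain ⟨m, hm⟩ := hdvd
    have hlt' : Nat.card (Subgroup.closure (S : Set G)) < Nat.card (Subgroup.closure (S' : Set G)) := by
      by_contra hge
      push Not at hge
      exact hne' (Subgroup.eq_of_le_of_card_ge hmono hge)
    have hm2 : 2 ≤ m := by
      rcases Nat.lt_or_ge m 2 with h | h
      · interval_cases m
        · rw [hm, mul_zero] at hlt'; exact absurd hlt' (Nat.not_lt_zero _)
        · rw [hm, mul_one] at hlt'; exact absurd hlt' (lt_irrefl _)
      · exact h
    have hS'2 : 2 ^ S'.card ≤ Nat.card (Subgroup.closure (S' : Set G)) := by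
      rw [hcard, pow_succ, hm]
      exact Nat.mul_le_mul hS2 hm2
    have hmem : S' ∈ 𝒮 := Finset.mem_filter.mpr ⟨Finset.mem_univ _, hsub, hS'2⟩
    have := hmax S' hmem
    omega

/-- Hence every subgroup of a finite group `G` is generated by at most `⌊log₂ |G|⌋` elements.
[folklore] -/
theorem exists_finset_closure_eq_card_le (H : Subgroup G) :
    ∃ S : Finset G, Subgroup.closure (S : Set G) = H ∧ S.card ≤ Nat.log 2 (Nat.card G) := by
  obtain ⟨S, hS, h2⟩ := exists_finset_closure_eq H
  refine ⟨S, hS, Nat.le_log_of_pow_le one_lt_two (h2.trans ?_)⟩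
  exact Subgroup.card_le_card_group H

/-- The subgroups of a finite group form a finite type (a theorem, used via `haveI`; no instance
is registered here). [folklore] -/
theorem finite_subgroup : Finite (Subgroup G) :=
  Finite.of_injective (fun H : Subgroup G => (H : Set G)) SetLike.coe_injective

/-- **`#{subgroups of G} ≤ (|G| + 1)^{⌊log₂ |G|⌋}`**: send a subgroup to a list of `≤ ⌊log₂|G|⌋`
generators, padded to a function `Fin ⌊log₂|G|⌋ → Option G`. [folklore] -/
theorem card_subgroup_le :
    Nat.card (Subgroup G) ≤ (Nat.card G + 1) ^ Nat.log 2 (Nat.card G) := by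
  classical
  haveI := Fintype.ofFinite G
  haveI : Finite (Subgroup G) := finite_subgroup
  set k := Nat.log 2 (Nat.card G) with hk
  choose S hS hSk using fun H : Subgroup G => exists_finset_closure_eq_card_le H
  let Φ : Subgroup G → (Fin k → Option G) := fun H i => (S H).toList[(i : ℕ)]?
  have hΦ : Function.Injective Φ := by
    intro H H' h
    have hlist : (S H).toList = (S H').toList := by
      apply List.ext_getElem?
      intro n
      by_cases hn : n < k
      · exact congrFun h ⟨n, hn⟩
      · push Not at hn
        have h1 : (S H).toList.length ≤ n := by rw [Finset.length_toList]; exact (hSk H).trans hn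
        have h2 : (S H').toList.length ≤ n := by rw [Finset.length_toList]; exact (hSk H').trans hn
        rw [List.getElem?_eq_none_iff.mpr h1, List.getElem?_eq_none_iff.mpr h2]
    have hSS : S H = S H' := by
      rw [← Finset.toList_toFinset (S H), ← Finset.toList_toFinset (S H'), hlist]
    rw [← hS H, ← hS H', hSS]
  calc Nat.card (Subgroup G) ≤ Nat.card (Fin k → Option G) := Nat.card_le_card_of_injective Φ hΦ
    _ = (Nat.card G + 1) ^ k := by
        rw [Nat.card_eq_fintype_card, Fintype.card_fun, Fintype.card_option, Fintype.card_fin,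
          Nat.card_eq_fintype_card]

end GroupTheory

/-! ### Independent draws generate, by the union bound over proper subgroups -/

section Probability

open Literature.Probability.Distributions MeasureTheory

variable {G : Type*} [Group G] [Finite G] {Ω : Type*}

/-- **Random draws generate a finite group.** Let `μ` be a law on `Ω`, `X : Ω → Set G` the group
elements read off an outcome, and suppose every proper subgroup `H` satisfies `μ{ω | X ω ⊆ H} ≤ θ`.
Then `T` independent draws fail to generate `G` with probability at most `#{subgroups of G} · θ^T`:
if `⟨⋃_t X ω_t⟩ = H ≠ ⊤` then every `X ω_t ⊆ H`, an event of probability `≤ θ^T` by independence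
(`toOuterMeasure_indepLaw_pi`), and there are `#{subgroups}` candidates for `H`.
[cite: CheungMosca2001, §3 (random elements generate)] -/
theorem toOuterMeasure_closure_ne_top_le (μ : PMF Ω) (X : Ω → Set G) {θ : ℝ≥0∞}
    (hθ : ∀ H : Subgroup G, H ≠ ⊤ → μ.toOuterMeasure {ω | X ω ⊆ H} ≤ θ) (T : ℕ) :
    (indepLaw T fun _ => μ).toOuterMeasure
        {w : Fin T → Ω | Subgroup.closure (⋃ t, X (w t)) ≠ ⊤} ≤
      Nat.card (Subgroup G) * θ ^ T := by
  classical
  haveI : Finite (Subgroup G) := finite_subgroup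
  haveI : Fintype (Subgroup G) := Fintype.ofFinite _
  -- the bad event is covered by the events "all draws inside `H`", `H` proper
  have hcover : {w : Fin T → Ω | Subgroup.closure (⋃ t, X (w t)) ≠ ⊤} ⊆
      ⋃ H : Subgroup G, {w | H ≠ ⊤ ∧ ∀ t, X (w t) ⊆ H} := by
    intro w hw
    refine Set.mem_iUnion.mpr ⟨Subgroup.closure (⋃ t, X (w t)), hw, fun t => ?_⟩
    exact (Set.subset_iUnion (fun t => X (w t)) t).trans Subgroup.subset_closure
  refine (measure_mono hcover).trans ((measure_iUnion_fintype_le _ _).trans ?_)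
  have hH : ∀ H : Subgroup G,
      (indepLaw T fun _ => μ).toOuterMeasure {w : Fin T → Ω | H ≠ ⊤ ∧ ∀ t, X (w t) ⊆ H} ≤ θ ^ T := by
    intro H
    by_cases hHt : H = ⊤
    · have : {w : Fin T → Ω | H ≠ ⊤ ∧ ∀ t, X (w t) ⊆ H} = ∅ := by
        ext w; simp [hHt]
      rw [this, measure_empty]
      exact bot_le
    · have hset : {w : Fin T → Ω | H ≠ ⊤ ∧ ∀ t, X (w t) ⊆ H} = {w | ∀ t, w t ∈ {ω | X ω ⊆ H}} := by
        ext w; simp [hHt]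
      rw [hset, toOuterMeasure_indepLaw_pi T (fun _ => μ) (fun _ => {ω | X ω ⊆ H})]
      calc ∏ _t : Fin T, μ.toOuterMeasure {ω | X ω ⊆ H} ≤ ∏ _t : Fin T, θ :=
            Finset.prod_le_prod' fun t _ => hθ H hHt
        _ = θ ^ T := by rw [Finset.prod_const, Finset.card_univ, Fintype.card_fin]
  calc ∑ H : Subgroup G, (indepLaw T fun _ => μ).toOuterMeasure {w | H ≠ ⊤ ∧ ∀ t, X (w t) ⊆ H}
      ≤ ∑ _H : Subgroup G, θ ^ T := Finset.sum_le_sum fun H _ => hH H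
    _ = Nat.card (Subgroup G) * θ ^ T := by
        rw [Finset.sum_const, Finset.card_univ, nsmul_eq_mul, Nat.card_eq_fintype_card]

/-- The same with the explicit subgroup count: the failure probability of `T` independent draws is
at most `(|G| + 1)^{⌊log₂|G|⌋} · θ^T`. [cite: CheungMosca2001, §3 (random elements generate)] -/
theorem toOuterMeasure_closure_ne_top_le' (μ : PMF Ω) (X : Ω → Set G) {θ : ℝ≥0∞}
    (hθ : ∀ H : Subgroup G, H ≠ ⊤ → μ.toOuterMeasure {ω | X ω ⊆ H} ≤ θ) (T : ℕ) :
    (indepLaw T fun _ => μ).toOuterMeasure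
        {w : Fin T → Ω | Subgroup.closure (⋃ t, X (w t)) ≠ ⊤} ≤
      ((Nat.card G + 1) ^ Nat.log 2 (Nat.card G) : ℕ) * θ ^ T := by
  refine (toOuterMeasure_closure_ne_top_le μ X hθ T).trans ?_
  gcongr
  exact_mod_cast card_subgroup_le

end Probability

end Literature.Computability.Cryptography.Hallgren2005

end
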